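import Literature.RingTheory.MvPowerSeries.HasseDerivDiffOp
import Literature.RingTheory.MvPowerSeries.HasseDerivOrder
import Literature.RingTheory.MvPowerSeries.HasseDerivSpan
import Literature.RingTheory.MvPowerSeries.MaximalIdealPow
import Mathlib.RingTheory.MvPowerSeries.Trunc
import Mathlib.RingTheory.PowerSeries.Basic
import HarnessLib

/-!
# K-β7-hat W2 (`BranchObstruction`), block β — LEADING TERMS along a branch (W4.1, OURS)

Second kernel block of the heart W2 (res-L0-w41-idea-1 `K7HatWords-idea-1-g12.lean` cbdb8a4f311bfcb9 l.223;
memo `CANONICAL-CLEANING-g10.md` §12.3 step (4) «leading-term extraction»; RULING 237(b)). Pure power-series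
algebra, no run vocabulary.

Setting: `γ : κ⟦X₀, X₁, X₂, X₃⟧ →+* L⟦τ⟧` a ring homomorphism with `γ X₀ = 0`, `τ ∣ γ X₁`,
`γ X₂ = τ^m ζ₁`, `γ X₃ = τ^m ω₁` (`m ≥ 1`; in W2: the parametrisation of a second branch of `Q₀ B`,
`X₀ = x`, `X₁ = y`, `X₂ = z̃`, `X₃ = w̃`, `m` the contact order of the branch with `V(z̃, w̃)`), and
`G ∈ κ⟦X⟧` whose monomials free of `X₀` have `(X₂, X₃)`-degree `≥ e` (in W2: `G = ∂F/∂z̃ ∈ (x, z̃, w̃)^{d−1}`,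
`e = d − 1`). For a divided derivative `Δ_α` in the variables `X₂, X₃` only (`α₀ = α₁ = 0`) of order
`k = |α| ≤ e`:

  `γ (Δ_α G) ≡ C(S_α) · τ^{(e−k)m}  (mod τ^{(e−k)m+1})`,
  `S_α = Σ_{a+b=e} C(β,α) · φ(G_{(0,0,a,b)}) · t₂^{a−α₂} t₃^{b−α₃}`

(`main_leading_term`), where `φ c := (γ (C c))(0)` is the induced map of coefficient fields `κ → L` and
`(t₂, t₃) = (ζ₁(0), ω₁(0))` is the tangent vector of the branch. `S_α` is the binary TAYLOR COEFFICIENT at `t`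
of the degree-`e` binary form `Σ φ(G_{(0,0,a,b)}) Z^a W^b` — block δ feeds it to `…TranslationTaylor`.

Route: truncate `G` below total degree `N = (e−k)m + k + 1` (the tail lies in `𝔪^N`, `Δ_α 𝔪^N ⊆ 𝔪^{N−k}`,
and `γ 𝔪^n ⊆ (τ^n)` — `X_pow_dvd_map_of_mem_pow`); expand the polynomial part monomial by monomial
(`hasseDeriv_monomial_add'`), and bound the `τ`-order of each term by the case analysis of the memo.

Everything here is OURS (the run's own bookkeeping), AI-written and AI-checked only — weaker than expert review;
nothing is a statement of [Hironaka2017]. -/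

set_option linter.dupNamespace false
set_option autoImplicit false

namespace Summit.ResolutionOfSingularities.ResolutionOfSingularities.Theorems.SwitchingDichotomy.BranchLeading

open Finset
open IsLocalRing (maximalIdeal)
open Literature.RingTheory.MvPowerSeries (hasseDeriv mchoose coeff_hasseDeriv_mchoose hasseDeriv_monomial_add'
  hasseDeriv_monomial_of_not_le' isDiffOpLE_hasseDeriv prod_X_pow_eq_monomial')
open Literature.RingTheory.MvPowerSeries.Jets (maximalIdeal_pow_eq_span_monomial sub_coe_truncTotal_mem_maximalIdeal_pow)
open Literature.AlgebraicGeometry.Resolution (IsDiffOpLE)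

variable {κ L : Type*} [Field κ] [CommRing L]

/-! ## §1 A local homomorphism `γ : κ⟦X⟧ → L⟦τ⟧` maps `𝔪^n` into `(τ^n)` -/

/-- If `τ ∣ γ(X_s)` for every variable, then `τ^{|β|} ∣ γ(X^β)`. OURS. -/
theorem X_pow_dvd_map_monomial {σ : Type*} [Fintype σ] (γ : MvPowerSeries σ κ →+* PowerSeries L)
    (hγ : ∀ s, PowerSeries.X ∣ γ (MvPowerSeries.X s)) (β : σ →₀ ℕ) :
    PowerSeries.X ^ β.degree ∣ γ (MvPowerSeries.monomial β (1 : κ)) := by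
  classical
  rw [← prod_X_pow_eq_monomial', map_prod, Finsupp.degree_eq_sum, ← Finset.prod_pow_eq_pow_sum]
  exact Finset.prod_dvd_prod_of_dvd _ _ fun s _ => by
    rw [map_pow]; exact pow_dvd_pow_of_dvd (hγ s) _

/-- **`γ(𝔪^n) ⊆ (τ^n)`** for a ring homomorphism `γ : κ⟦X⟧ → L⟦τ⟧` with `τ ∣ γ(X_s)` for all `s`. OURS. -/
theorem X_pow_dvd_map_of_mem_pow {σ : Type*} [Fintype σ] (γ : MvPowerSeries σ κ →+* PowerSeries L)
    (hγ : ∀ s, PowerSeries.X ∣ γ (MvPowerSeries.X s)) {n : ℕ} {f : MvPowerSeries σ κ}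
    (hf : f ∈ maximalIdeal (MvPowerSeries σ κ) ^ n) : PowerSeries.X ^ n ∣ γ f := by
  rw [maximalIdeal_pow_eq_span_monomial] at hf
  rw [← Ideal.mem_span_singleton]
  have hmap : Ideal.map γ (Ideal.span ((fun e : σ →₀ ℕ => MvPowerSeries.monomial e (1 : κ)) '' {e | e.degree = n}))
      ≤ Ideal.span {PowerSeries.X ^ n} := by
    rw [Ideal.map_span, Ideal.span_le]
    rintro _ ⟨_, ⟨β, hβ, rfl⟩, rfl⟩
    rw [SetLike.mem_coe, Ideal.mem_span_singleton]
    have h := X_pow_dvd_map_monomial γ hγ β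
    rw [Set.mem_setOf_eq] at hβ
    rwa [hβ] at h
  exact hmap (Ideal.mem_map_of_mem γ hf)

/-! ## §2 Divided derivatives of monomials and the expansion of `γ (Δ_α p)` for a polynomial `p` -/

/-- `C(m, a) = 0` unless `a ≤ m` (the tree's lemma of the same name is private). OURS. -/
theorem mchoose_eq_zero_of_not_le {σ : Type*} [Fintype σ] {m a : σ →₀ ℕ} (h : ¬ a ≤ m) :
    mchoose m a = 0 := by
  obtain ⟨s, hs⟩ : ∃ s, ¬ a s ≤ m s := not_forall.mp fun h' => h (Finsupp.le_def.mpr h')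
  exact Finset.prod_eq_zero (Finset.mem_univ s) (Nat.choose_eq_zero_of_lt (not_le.mp hs))

/-- **`Δ_α` of a monomial**: `Δ_α (c X^β) = C(β, α)·c·X^{β−α}` if `α ≤ β`, and `0` otherwise. OURS. -/
theorem hasseDeriv_monomial {σ : Type*} [Fintype σ] [DecidableEq σ] (α β : σ →₀ ℕ) (c : κ) :
    hasseDeriv α (MvPowerSeries.monomial β c) =
      if α ≤ β then MvPowerSeries.monomial (β - α) ((mchoose β α : κ) * c) else 0 := by
  split_ifs with h
  · ext δ
    rw [coeff_hasseDeriv_mchoose, MvPowerSeries.coeff_monomial, MvPowerSeries.coeff_monomial]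
    by_cases hδ : δ = β - α
    · subst hδ
      rw [if_pos (add_tsub_cancel_of_le h), if_pos rfl, add_tsub_cancel_of_le h]
    · have h' : ¬ α + δ = β := fun e => hδ (by rw [← e, add_tsub_cancel_left])
      rw [if_neg h', if_neg hδ, mul_zero]
  · exact hasseDeriv_monomial_of_not_le' h c

/-- `γ (X^δ) = ∏_s γ(X_s)^{δ_s}`. OURS. -/
theorem map_monomial_one {σ : Type*} [Fintype σ] (γ : MvPowerSeries σ κ →+* PowerSeries L) (δ : σ →₀ ℕ) :
    γ (MvPowerSeries.monomial δ (1 : κ)) = ∏ s, γ (MvPowerSeries.X s) ^ δ s := by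
  rw [← prod_X_pow_eq_monomial', map_prod]
  exact Finset.prod_congr rfl fun s _ => map_pow γ _ _

/-- `c X^δ = C(c) · X^δ` in `κ⟦X⟧`. OURS. -/
theorem monomial_eq_C_mul_monomial_one {σ : Type*} (δ : σ →₀ ℕ) (c : κ) :
    MvPowerSeries.monomial δ c = MvPowerSeries.C c * MvPowerSeries.monomial δ (1 : κ) := by
  rw [← MvPowerSeries.monomial_zero_eq_C_apply, MvPowerSeries.monomial_mul_monomial, zero_add, mul_one]

/-- **Expansion of `γ (Δ_α p)` for a polynomial `p`**, monomial by monomial. OURS. -/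
theorem map_hasseDeriv_coe {σ : Type*} [Fintype σ] [DecidableEq σ] (γ : MvPowerSeries σ κ →+* PowerSeries L)
    (α : σ →₀ ℕ) (p : MvPolynomial σ κ) :
    γ (hasseDeriv α (p : MvPowerSeries σ κ)) =
      ∑ β ∈ p.support, if α ≤ β then
        γ (MvPowerSeries.C ((mchoose β α : κ) * MvPolynomial.coeff β p)) * ∏ s, γ (MvPowerSeries.X s) ^ (β - α) s
        else 0 := by
  conv_lhs => rw [p.as_sum, ← MvPolynomial.coeToMvPowerSeries.ringHom_apply, map_sum, map_sum, map_sum]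
  refine Finset.sum_congr rfl fun β _ => ?_
  rw [MvPolynomial.coeToMvPowerSeries.ringHom_apply, MvPolynomial.coe_monomial, hasseDeriv_monomial]
  split_ifs with h
  · rw [monomial_eq_C_mul_monomial_one, map_mul, map_monomial_one]
  · rw [map_zero]

/-! ## §3 The branch setting in four variables and the term-by-term bound -/

section Branch

variable (γ : MvPowerSeries (Fin 4) κ →+* PowerSeries L)
  (h0 : γ (MvPowerSeries.X 0) = 0) (hy : PowerSeries.X ∣ γ (MvPowerSeries.X 1))
  (ζ₁ ω₁ : PowerSeries L) {m : ℕ} (hm : 1 ≤ m)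
  (h2 : γ (MvPowerSeries.X 2) = PowerSeries.X ^ m * ζ₁) (h3 : γ (MvPowerSeries.X 3) = PowerSeries.X ^ m * ω₁)

include h0 hy hm h2 h3 in
/-- Every variable goes to the maximal ideal `(τ)`. OURS. -/
theorem X_dvd_map_X : ∀ s : Fin 4, PowerSeries.X ∣ γ (MvPowerSeries.X s) := by
  intro s
  fin_cases s
  · simp only [Fin.zero_eta, h0, dvd_zero]
  · exact hy
  · simp only [Fin.reduceFinMk, h2]
    exact Dvd.dvd.mul_right (dvd_pow_self _ (by omega)) _
  · simp only [Fin.reduceFinMk, h3]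
    exact Dvd.dvd.mul_right (dvd_pow_self _ (by omega)) _

/-- The PURE `(X₂, X₃)`-exponents of degree `e`: `(0, 0, a, e − a)`, `a = 0..e`. OURS. -/
theorem mem_pure_iff (e : ℕ) (β : Fin 4 →₀ ℕ) :
    β ∈ (Finset.range (e + 1)).image (fun a => Finsupp.single (2 : Fin 4) a + Finsupp.single 3 (e - a)) ↔
      β 0 = 0 ∧ β 1 = 0 ∧ β 2 + β 3 = e := by
  constructor
  · rintro h
    obtain ⟨a, ha, rfl⟩ := Finset.mem_image.mp h
    rw [Finset.mem_range] at ha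
    refine ⟨by simp, by simp, ?_⟩
    simp only [Finsupp.add_apply, Finsupp.single_apply]
    simp; omega
  · rintro ⟨hβ0, hβ1, hβe⟩
    refine Finset.mem_image.mpr ⟨β 2, Finset.mem_range.mpr (by omega), ?_⟩
    ext s
    fin_cases s
    · simpa using hβ0.symm
    · simpa using hβ1.symm
    · simp
    · simp; omega

include h0 hy hm h2 h3 in
/-- **Term-by-term bound** (the case analysis of memo §12.3 (4)): for one monomial `c X^β` of `G` (with
`β₀ = 0 → e ≤ β₂ + β₃`) and a pure `(X₂, X₃)`-derivative `Δ_α` of order `k = α₂ + α₃ ≤ e`, the term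
`γ (Δ_α (c X^β))` is `≡ 0 (mod τ^{(e−k)m+1})` unless `β = (0, 0, a, b)` with `a + b = e`, in which case it is
`≡ C(β, α) φ(c) t₂^{a−α₂} t₃^{b−α₃} τ^{(e−k)m}`. OURS. -/
theorem term_bound {e : ℕ} (α β : Fin 4 →₀ ℕ) (c : κ) (hα0 : α 0 = 0) (hα1 : α 1 = 0)
    (hαe : α 2 + α 3 ≤ e) (hβ : β 0 = 0 → e ≤ β 2 + β 3) :
    PowerSeries.X ^ ((e - (α 2 + α 3)) * m + 1) ∣
      (if α ≤ β then γ (MvPowerSeries.C ((mchoose β α : κ) * c)) * ∏ s, γ (MvPowerSeries.X s) ^ (β - α) s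
        else 0) -
      (if β 0 = 0 ∧ β 1 = 0 ∧ β 2 + β 3 = e then
        PowerSeries.C ((mchoose β α : L) * PowerSeries.constantCoeff (γ (MvPowerSeries.C c)) *
          PowerSeries.constantCoeff ζ₁ ^ (β 2 - α 2) * PowerSeries.constantCoeff ω₁ ^ (β 3 - α 3)) *
          PowerSeries.X ^ ((e - (α 2 + α 3)) * m)
        else 0) := by
  -- shorthand
  set M := (e - (α 2 + α 3)) * m with hM
  set T : PowerSeries L := PowerSeries.X with hT
  set gC := γ (MvPowerSeries.C ((mchoose β α : κ) * c)) with hgC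
  by_cases hle : α ≤ β
  · have hle' := Finsupp.le_def.mp hle
    have e0 : (β - α) 0 = β 0 := by rw [Finsupp.tsub_apply, hα0, tsub_zero]
    have e1 : (β - α) 1 = β 1 := by rw [Finsupp.tsub_apply, hα1, tsub_zero]
    have e2 : (β - α) 2 = β 2 - α 2 := Finsupp.tsub_apply _ _ _
    have e3 : (β - α) 3 = β 3 - α 3 := Finsupp.tsub_apply _ _ _
    rw [if_pos hle, Fin.prod_univ_four, e0, e1, e2, e3]
    by_cases hβ0 : β 0 = 0
    · have heβ := hβ hβ0
      rw [hβ0, pow_zero, one_mul, h2, h3, mul_pow, mul_pow, ← pow_mul, ← pow_mul]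
      -- name the exponents
      set i := β 2 - α 2 with hi
      set j := β 3 - α 3 with hj
      by_cases hsum : β 2 + β 3 = e
      · -- `(X₂, X₃)`-degree exactly `e`: the `τ`-power is exactly `M`
        have hexp : m * i + m * j = M := by
          rw [hM, ← mul_add, mul_comm]
          congr 1
          have := hle' 2; have := hle' 3; omega
        have hXM : T ^ (m * i) * T ^ (m * j) = T ^ M := by rw [← pow_add, hexp]
        have hre : gC * (γ (MvPowerSeries.X 1) ^ β 1 * (T ^ (m * i) * ζ₁ ^ i) * (T ^ (m * j) * ω₁ ^ j)) =
            T ^ M * (γ (MvPowerSeries.X 1) ^ β 1 * (gC * (ζ₁ ^ i * ω₁ ^ j))) := by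
          rw [← hXM]; ring
        rw [hre]
        by_cases hβ1 : β 1 = 0
        · -- the PURE case: compare constant coefficients of the cofactors of `τ^M`
          rw [if_pos ⟨rfl, hβ1, hsum⟩, hβ1, pow_zero, one_mul, mul_comm (PowerSeries.C _) (T ^ M), ← mul_sub,
            pow_succ]
          refine mul_dvd_mul_left _ ?_
          rw [hT, PowerSeries.X_dvd_iff]
          simp only [map_sub, map_mul, map_pow, PowerSeries.constantCoeff_C, hgC, map_natCast]
          ring
        · -- `β₁ ≥ 1`: an extra factor `γ(X₁)`, divisible by `τ`
          rw [if_neg (fun h => hβ1 h.2.1), sub_zero, pow_succ]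
          refine mul_dvd_mul_left _ (Dvd.dvd.mul_right ?_ _)
          obtain ⟨b1, hb1⟩ : ∃ b1, β 1 = b1 + 1 := ⟨β 1 - 1, by omega⟩
          rw [hb1, pow_succ]
          exact Dvd.dvd.mul_left hy _
      · -- `(X₂, X₃)`-degree `≥ e + 1`: the `τ`-power alone is `≥ M + m ≥ M + 1`
        rw [if_neg (fun h => hsum h.2.2), sub_zero]
        have hbig : M + 1 ≤ m * i + m * j := by
          rw [hM, ← mul_add]
          have := hle' 2; have := hle' 3
          have h1 : e - (α 2 + α 3) + 1 ≤ i + j := by omega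
          calc (e - (α 2 + α 3)) * m + 1 ≤ (e - (α 2 + α 3)) * m + m := by omega
            _ = m * (e - (α 2 + α 3) + 1) := by ring
            _ ≤ m * (i + j) := Nat.mul_le_mul_left m h1
        obtain ⟨r, hr⟩ : ∃ r, m * i + m * j = M + 1 + r := ⟨_, (Nat.add_sub_cancel' hbig).symm⟩
        have hX : T ^ (m * i) * T ^ (m * j) = T ^ (M + 1) * T ^ r := by rw [← pow_add, hr, pow_add]
        have hre : gC * (γ (MvPowerSeries.X 1) ^ β 1 * (T ^ (m * i) * ζ₁ ^ i) * (T ^ (m * j) * ω₁ ^ j)) =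
            T ^ (M + 1) * (T ^ r * gC * γ (MvPowerSeries.X 1) ^ β 1 * ζ₁ ^ i * ω₁ ^ j) := by
          calc _ = (T ^ (m * i) * T ^ (m * j)) * gC * γ (MvPowerSeries.X 1) ^ β 1 * ζ₁ ^ i * ω₁ ^ j := by ring
            _ = _ := by rw [hX]; ring
        rw [hre]
        exact Dvd.intro _ rfl
    · -- `β₀ ≥ 1`: the factor `γ(X₀)^{β₀} = 0`
      rw [if_neg (fun h => hβ0 h.1), sub_zero, h0, zero_pow hβ0]
      simp
  · rw [if_neg hle, zero_sub]
    split_ifs with hP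
    · rw [mchoose_eq_zero_of_not_le hle, Nat.cast_zero, zero_mul, zero_mul, zero_mul, map_zero, zero_mul,
        neg_zero]
      exact dvd_zero _
    · rw [neg_zero]; exact dvd_zero _

include h0 hy hm h2 h3 in
/-- **LEADING TERM of `γ (Δ_α G)` along the branch** (memo §12.3 (4)). `G ∈ κ⟦X₀..X₃⟧` with every
`X₀`-free monomial of `(X₂, X₃)`-degree `≥ e`; `Δ_α` a pure `(X₂, X₃)`-derivative of order `k = α₂ + α₃ ≤ e`. Then
modulo `τ^{(e−k)m+1}`, `γ (Δ_α G)` is `C(S_α)·τ^{(e−k)m}` with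
`S_α = Σ_{β pure of degree e} C(β, α) φ(G_β) t₂^{β₂−α₂} t₃^{β₃−α₃}` — the binary Taylor coefficient at the
tangent vector `t = (ζ₁(0), ω₁(0))` of the degree-`e` binary form `Σ φ(G_β) Z^{β₂} W^{β₃}`. OURS. -/
theorem main_leading_term (G : MvPowerSeries (Fin 4) κ) (e : ℕ)
    (hG : ∀ β : Fin 4 →₀ ℕ, MvPowerSeries.coeff β G ≠ 0 → β 0 = 0 → e ≤ β 2 + β 3)
    (α : Fin 4 →₀ ℕ) (hα0 : α 0 = 0) (hα1 : α 1 = 0) (hαe : α 2 + α 3 ≤ e) :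
    PowerSeries.X ^ ((e - (α 2 + α 3)) * m + 1) ∣
      γ (hasseDeriv α G) -
        PowerSeries.C (∑ β ∈ (Finset.range (e + 1)).image
            (fun a => Finsupp.single (2 : Fin 4) a + Finsupp.single 3 (e - a)),
          (mchoose β α : L) * PowerSeries.constantCoeff (γ (MvPowerSeries.C (MvPowerSeries.coeff β G))) *
            PowerSeries.constantCoeff ζ₁ ^ (β 2 - α 2) * PowerSeries.constantCoeff ω₁ ^ (β 3 - α 3)) *
        PowerSeries.X ^ ((e - (α 2 + α 3)) * m) := by
  classical
  set k := α 2 + α 3 with hk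
  set M := (e - k) * m with hM
  set N := M + k + 1 with hN
  set PE := (Finset.range (e + 1)).image (fun a => Finsupp.single (2 : Fin 4) a + Finsupp.single 3 (e - a))
    with hPE
  have hdegα : α.degree = k := by
    rw [Finsupp.degree_eq_sum, Fin.sum_univ_four, hα0, hα1, hk]; ring
  -- truncation below total degree `N`
  set p := MvPowerSeries.truncTotal N G with hp
  have htail : G - (p : MvPowerSeries (Fin 4) κ) ∈ maximalIdeal (MvPowerSeries (Fin 4) κ) ^ N :=
    sub_coe_truncTotal_mem_maximalIdeal_pow N G
  have hΔtail : hasseDeriv α (G - (p : MvPowerSeries (Fin 4) κ)) ∈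
      maximalIdeal (MvPowerSeries (Fin 4) κ) ^ (M + 1) := by
    have h := IsDiffOpLE.apply_mem_pow_sub (maximalIdeal (MvPowerSeries (Fin 4) κ)) N
      (isDiffOpLE_hasseDeriv (A := κ) α.degree α le_rfl) htail
    rwa [hdegα, hN, show M + k + 1 - k = M + 1 by omega] at h
  have hγtail : PowerSeries.X ^ (M + 1) ∣ γ (hasseDeriv α (G - (p : MvPowerSeries (Fin 4) κ))) :=
    X_pow_dvd_map_of_mem_pow γ (X_dvd_map_X γ h0 hy ζ₁ ω₁ hm h2 h3) hΔtail
  -- coefficients of the truncation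
  have hcoeffp : ∀ β ∈ p.support, MvPolynomial.coeff β p = MvPowerSeries.coeff β G ∧ β.degree < N := by
    intro β hβ
    have hne := MvPolynomial.mem_support_iff.mp hβ
    rw [hp, MvPowerSeries.coeff_truncTotal_eq_ite] at hne ⊢
    by_cases hd : β.degree < N
    · exact ⟨by rw [if_pos hd], hd⟩
    · exact absurd (by rw [if_neg hd]) hne
  -- the polynomial part, term by term
  have hpoly := map_hasseDeriv_coe γ α p
  -- the pure part `C S · τ^M` as a sum over `p.support`
  set f : (Fin 4 →₀ ℕ) → PowerSeries L := fun β =>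
    PowerSeries.C ((mchoose β α : L) * PowerSeries.constantCoeff (γ (MvPowerSeries.C (MvPowerSeries.coeff β G))) *
      PowerSeries.constantCoeff ζ₁ ^ (β 2 - α 2) * PowerSeries.constantCoeff ω₁ ^ (β 3 - α 3)) *
      PowerSeries.X ^ M with hf
  have hmain : PowerSeries.C (∑ β ∈ PE,
        (mchoose β α : L) * PowerSeries.constantCoeff (γ (MvPowerSeries.C (MvPowerSeries.coeff β G))) *
          PowerSeries.constantCoeff ζ₁ ^ (β 2 - α 2) * PowerSeries.constantCoeff ω₁ ^ (β 3 - α 3)) *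
        PowerSeries.X ^ M =
      ∑ β ∈ p.support, (if β 0 = 0 ∧ β 1 = 0 ∧ β 2 + β 3 = e then
        PowerSeries.C ((mchoose β α : L) * PowerSeries.constantCoeff (γ (MvPowerSeries.C (MvPolynomial.coeff β p))) *
          PowerSeries.constantCoeff ζ₁ ^ (β 2 - α 2) * PowerSeries.constantCoeff ω₁ ^ (β 3 - α 3)) *
          PowerSeries.X ^ M else 0) := by
    rw [map_sum, Finset.sum_mul]
    -- right-hand side = sum of `f` over the filtered support
    have hR : ∑ β ∈ p.support, (if β 0 = 0 ∧ β 1 = 0 ∧ β 2 + β 3 = e then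
        PowerSeries.C ((mchoose β α : L) * PowerSeries.constantCoeff (γ (MvPowerSeries.C (MvPolynomial.coeff β p))) *
          PowerSeries.constantCoeff ζ₁ ^ (β 2 - α 2) * PowerSeries.constantCoeff ω₁ ^ (β 3 - α 3)) *
          PowerSeries.X ^ M else 0) =
        ∑ β ∈ p.support.filter (fun β => β 0 = 0 ∧ β 1 = 0 ∧ β 2 + β 3 = e), f β := by
      rw [Finset.sum_filter]
      refine Finset.sum_congr rfl fun β hβ => ?_
      split_ifs with hc
      · rw [hf, (hcoeffp β hβ).1]
      · rfl
    rw [hR]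
    symm
    apply Finset.sum_subset
    · intro β hβ
      rw [Finset.mem_filter] at hβ
      exact (mem_pure_iff e β).mpr hβ.2
    · intro β hβPE hβnot
      have hcond := (mem_pure_iff e β).mp hβPE
      have hnotsupp : β ∉ p.support := fun h => hβnot (Finset.mem_filter.mpr ⟨h, hcond⟩)
      have hdeg : β.degree < N := by
        rw [Finsupp.degree_eq_sum, Fin.sum_univ_four, hcond.1, hcond.2.1, zero_add, zero_add, hcond.2.2, hN, hM]
        have : e - k ≤ (e - k) * m := Nat.le_mul_of_pos_right _ (by omega)
        omega
      have hzero : MvPowerSeries.coeff β G = 0 := by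
        have h := MvPolynomial.notMem_support_iff.mp hnotsupp
        rwa [hp, MvPowerSeries.coeff_truncTotal_eq_ite, if_pos hdeg] at h
      show f β = 0
      simp only [hf, hzero, map_zero, mul_zero, zero_mul]
  -- assemble
  have hsplit : γ (hasseDeriv α G) = γ (hasseDeriv α (p : MvPowerSeries (Fin 4) κ)) +
      γ (hasseDeriv α (G - (p : MvPowerSeries (Fin 4) κ))) := by
    rw [← map_add, ← map_add, add_sub_cancel]
  rw [hsplit, hpoly, hmain, add_sub_right_comm, ← Finset.sum_sub_distrib]
  refine dvd_add (Finset.dvd_sum fun β hβ => ?_) hγtail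
  exact term_bound γ h0 hy ζ₁ ω₁ hm h2 h3 α β (MvPolynomial.coeff β p) hα0 hα1 hαe
    (fun hβ0 => hG β (by rw [← (hcoeffp β hβ).1]; exact MvPolynomial.mem_support_iff.mp hβ) hβ0)

end Branch

end Summit.ResolutionOfSingularities.ResolutionOfSingularities.Theorems.SwitchingDichotomy.BranchLeading
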